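import Summits.QuantumFields.BalabanUV.Beta.FP.HorizontalBookkeeping

/-!
# `BalabanUV.Beta.FP.HorizontalBookkeepingNearTail` — road «FP» for binder row D1, row **H3-BOOK (nearTail)** (owner, GAMMA-DESIGN v1.3 §11; a letter of the
# direct γ-END `FP/HorizontalRemainder` p244692): the transport of the TAIL `K − K·𝟙[‖z‖∞ ≤ N]` of the comparison kernel by ℓ¹ weights has UNIFORMLY SMALL entries —
# `|N⁸·dressedEntry w (K − truncK K N) (N•v) a b| ≤ 16·C_K·C_w²` for EVERY coarse offset `v`, n-free ([folklore] bookkeeping of absolutely convergent double sums)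

HONEST DEPENDENCY (page 1, mandatory): continuum YM on T⁴ ⇐ BetaPertH ∧ nine spine estimates (0/9 proved); BetaPertH ⇐ (D1) ∧ (D4) ∧ CAP+tail;
G-an2-4 gates asym, D1 and NE2/3/4.  HONEST FRAMING (cell contract, verbatim): «discharging `BetaPertH` makes Bałaban's UV stability UNCONDITIONAL — a real
constructive-QFT result; it is NOT the continuum limit and NOT the Clay problem.»  THIS MODULE is [folklore] real analysis over b12's `DecimatedMomentSummable.dressedSum`,
`DressedMomentNormalisation.dressedEntry` and leaf-02's `HorizontalBookkeeping.truncK` BY NAME; every analytic input is a displayed hypothesis; no `def`, no `def … : Prop`,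
nothing cited, 0 sorry.  NOT hbook, NOT D1, NOT BetaPertH, NOT continuum, NOT Clay.

ABSOLUTE RULE (cell charter, verbatim): «No internally-minted statement may enter as a cited fact. Every hypothesis is either kernel-proved in this package or a
verbatim quotation of a PUBLISHED theorem with page reference. The manuscript(s) under audit are NOT citable for their own disputed steps — they are the thing
under adjudication; programme-internal (2001/route/tribunal) claims are never citable.»

WHY (p244692's letter (near), piece «near-tail of the transport»; `RESIDUAL-FP.md` §2 last row).  The direct γ-END splits the one-shot kernel against the TRUNCATED
transport `Xtr = N⁸·dressedEntry w (truncK K N) (N•·)`; the one shot itself pairs with the FULL transport `N⁸·dressedEntry w K (N•·)` (six loops vs `K`, GAMMA-5), so the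
difference — the transport of the tail `K − truncK K N` — is one of the (near) pieces.  With the decay letter `|K c e z| ≤ C_K∕(‖z‖∞+1)⁶` (`hK` of H2-ASM-5 ∕ KER) the tail is
UNIFORMLY `≤ C_K·(N+1)⁻⁶`, and with the ℓ¹ weight letter `Σ'_u |w κ l u| ≤ C_w∕N` (the minimiser spreads a unit coarse variation as `~N⁻⁵` over `~N⁴` fine bonds; supplier
IR-I ∕ GAMMA-1 LETTERS) the two masses pay `N⁻²`; the `N⁸` is exactly absorbed: `N⁸·(N+1)⁻⁶·N⁻² ≤ 1`.

CONTENT.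
* §1 `abs_dressedSum_le_of_sup` — `|dressedSum w T w′ y| ≤ ε·(Σ'|w|)·(Σ'|w′|)` for ℓ¹ patterns and `|T| ≤ ε` (every `y`); `abs_dressedEntry_le_of_sup` — the `4 × 4` entry sum:
  `|dressedEntry w T y a b| ≤ 16·ε·m²` under `Σ'|w κ l| ≤ m`.
* §2 `abs_tail_le` — `|(K − truncK K N) c e z| ≤ C_K∕(N+1)⁶`; **`abs_transportTail_le`** — `|N⁸·dressedEntry w (K − truncK K N) (N•v) a b| ≤ 16·C_K·C_w²` for every `v`, `N ≥ 1`.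
Provenance: road FP OWNER b2b-balaban-beta-d1-p3 gen 7 (prover-b2b-balaban-beta-d1-p3-g7-0), 2026-08-21, row H3-BOOK (nearTail); «not in print; our bookkeeping».
-/

noncomputable section

namespace Summit.QuantumFields.BalabanUV.Beta.FP.HorizontalBookkeepingNearTail

open Finset
open Literature.MathematicalPhysics.QuantumFieldTheory.Balaban1983to89.Beta
open Literature.MathematicalPhysics.QuantumFieldTheory.Balaban1983to89.Beta.DyadicShell (Pt supNorm)
open Literature.MathematicalPhysics.QuantumFieldTheory.Balaban1983to89.Beta.DecimatedMomentSummable (dressedSum)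
open Literature.MathematicalPhysics.QuantumFieldTheory.Balaban1983to89.Beta.DressedMomentNormalisation (EKer dressedEntry)
open Summit.QuantumFields.BalabanUV.Beta.FP.HorizontalBookkeeping (truncK truncK_apply)

/-! ## §1 Dressed sums against a uniformly small kernel -/

/-- [folklore] **ℓ¹ ⊗ sup ⊗ ℓ¹**: for absolutely summable patterns `w, w′` on `ℤ⁴` and a kernel with `|T z| ≤ ε` everywhere,
`|dressedSum w T w′ y| ≤ ε·(Σ'_u |w u|)·(Σ'_x |w′ x|)` for every output point `y`. -/
theorem abs_dressedSum_le_of_sup {w T w' : Pt → ℝ} {ε : ℝ} (hw : Summable fun u => |w u|) (hw' : Summable fun x => |w' x|)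
    (hT : ∀ z, |T z| ≤ ε) (y : Pt) :
    |dressedSum w T w' y| ≤ ε * (∑' u, |w u|) * (∑' x, |w' x|) := by
  have hε : 0 ≤ ε := (abs_nonneg _).trans (hT 0)
  unfold dressedSum
  have hGs : Summable fun p : Pt × Pt => (ε * |w p.1|) * |w' p.2| :=
    (hw.mul_left ε).mul_of_nonneg hw' (fun u => by positivity) (fun x => abs_nonneg _)
  have hFle : ∀ p : Pt × Pt, |w p.1 * T (y + p.1 - p.2) * w' p.2| ≤ (ε * |w p.1|) * |w' p.2| := by
    intro p
    rw [abs_mul, abs_mul]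
    calc |w p.1| * |T (y + p.1 - p.2)| * |w' p.2| ≤ |w p.1| * ε * |w' p.2| := by
          gcongr
          exact hT _
      _ = ε * |w p.1| * |w' p.2| := by ring
  have hFabs : Summable fun p : Pt × Pt => |w p.1 * T (y + p.1 - p.2) * w' p.2| :=
    Summable.of_nonneg_of_le (fun p => abs_nonneg _) hFle hGs
  have hF : Summable fun p : Pt × Pt => w p.1 * T (y + p.1 - p.2) * w' p.2 := hFabs.of_abs
  have hprod : (∑' u, ε * |w u|) * (∑' x, |w' x|) = ∑' p : Pt × Pt, (ε * |w p.1|) * |w' p.2| :=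
    (hw.mul_left ε).tsum_mul_tsum hw' hGs
  have hup : ∑' p : Pt × Pt, w p.1 * T (y + p.1 - p.2) * w' p.2 ≤ ∑' p : Pt × Pt, (ε * |w p.1|) * |w' p.2| :=
    hF.tsum_le_tsum (fun p => (le_abs_self _).trans (hFle p)) hGs
  have hdown : -(∑' p : Pt × Pt, w p.1 * T (y + p.1 - p.2) * w' p.2) ≤ ∑' p : Pt × Pt, (ε * |w p.1|) * |w' p.2| := by
    rw [← tsum_neg]
    exact hF.neg.tsum_le_tsum (fun p => (neg_le_abs _).trans (hFle p)) hGs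
  have e : ε * (∑' u, |w u|) * (∑' x, |w' x|) = ∑' p : Pt × Pt, (ε * |w p.1|) * |w' p.2| := by
    rw [← hprod, tsum_mul_left]
  rw [e]
  exact abs_le.mpr ⟨by linarith, hup⟩

/-- [folklore] **THE ENTRY FORM** (`d = 4`): with the ℓ¹ weight letter `Σ'_u |w κ l u| ≤ m` for all `κ, l` and `|T c e z| ≤ ε` for all `c, e, z`,
`|dressedEntry w T y a b| ≤ 16·ε·m²` (the `4 × 4` channel sum). -/
theorem abs_dressedEntry_le_of_sup {w T : EKer 4} {ε m : ℝ} (hws : ∀ κ l, Summable fun u => |w κ l u|) (hwm : ∀ κ l, ∑' u, |w κ l u| ≤ m)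
    (hT : ∀ c e z, |T c e z| ≤ ε) (y : Pt) (a b : Fin 4) :
    |dressedEntry w T y a b| ≤ 16 * ε * m ^ 2 := by
  have hε : 0 ≤ ε := (abs_nonneg _).trans (hT 0 0 0)
  have hm : 0 ≤ m := le_trans (tsum_nonneg fun u => abs_nonneg (w 0 0 u)) (hwm 0 0)
  have hterm : ∀ c e : Fin 4, |dressedSum (w c a) (T c e) (w e b) y| ≤ ε * m * m := by
    intro c e
    calc |dressedSum (w c a) (T c e) (w e b) y| ≤ ε * (∑' u, |w c a u|) * (∑' x, |w e b x|) :=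
          abs_dressedSum_le_of_sup (hws c a) (hws e b) (hT c e) y
      _ ≤ ε * m * m := by
          have h1 := hwm c a; have h2 := hwm e b
          have h0 : 0 ≤ ∑' u, |w c a u| := tsum_nonneg fun u => abs_nonneg _
          have h0' : 0 ≤ ∑' x, |w e b x| := tsum_nonneg fun x => abs_nonneg _
          gcongr
  unfold dressedEntry
  calc |∑ c, ∑ e, dressedSum (w c a) (T c e) (w e b) y| ≤ ∑ c, ∑ e, |dressedSum (w c a) (T c e) (w e b) y| :=
        (Finset.abs_sum_le_sum_abs _ _).trans (Finset.sum_le_sum fun c _ => Finset.abs_sum_le_sum_abs _ _)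
    _ ≤ ∑ _c : Fin 4, ∑ _e : Fin 4, ε * m * m := Finset.sum_le_sum fun c _ => Finset.sum_le_sum fun e _ => hterm c e
    _ = 16 * ε * m ^ 2 := by simp only [Finset.sum_const, Finset.card_univ, Fintype.card_fin, nsmul_eq_mul]; push_cast; ring

/-! ## §2 The transported TAIL of the comparison kernel -/

/-- [folklore] **THE TAIL IS UNIFORMLY SMALL**: with `|K c e z| ≤ C_K∕(‖z‖∞+1)⁶`, the tail kernel `K − truncK K N` satisfies `|(K − truncK K N) c e z| ≤ C_K∕(N+1)⁶` everywhere. -/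
theorem abs_tail_le {K : EKer 4} {CK : ℝ} {N : ℕ} (hK : ∀ c e (z : Pt), |K c e z| ≤ CK / ((supNorm z : ℝ) + 1) ^ 6)
    (c e : Fin 4) (z : Pt) :
    |K c e z - truncK K N c e z| ≤ CK / ((N : ℝ) + 1) ^ 6 := by
  have hCK : 0 ≤ CK := by
    have h := hK 0 0 0
    have hs : ((supNorm (0 : Pt) : ℝ) + 1) = 1 := by rw [DyadicShell.supNorm_eq_zero_iff.mpr rfl]; simp
    rw [hs, one_pow, div_one] at h
    exact (abs_nonneg _).trans h
  rw [truncK_apply]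
  split_ifs with h
  · rw [sub_self, abs_zero]; positivity
  · rw [sub_zero]
    have hN : (N : ℝ) + 1 ≤ (supNorm z : ℝ) + 1 := by
      have h' : (N : ℝ) ≤ supNorm z := by exact_mod_cast (not_le.mp h).le
      linarith
    calc |K c e z| ≤ CK / ((supNorm z : ℝ) + 1) ^ 6 := hK c e z
      _ ≤ CK / ((N : ℝ) + 1) ^ 6 := by
          apply div_le_div_of_nonneg_left hCK (by positivity)
          exact pow_le_pow_left₀ (by positivity) hN 6

/-- **THE NEAR ENTRIES OF THE TRANSPORTED TAIL ARE O(1), n-FREE** (row H3-BOOK (nearTail); a (near) piece of p244692): with the decay letter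
`|K c e z| ≤ C_K∕(‖z‖∞+1)⁶` and the ℓ¹ weight letter `Σ'_u |w κ l u| ≤ C_w∕N` (`N ≥ 1`), for EVERY coarse offset `v` and channel `(a, b)`:
`|N⁸·dressedEntry w (K − truncK K N) (N•v) a b| ≤ 16·C_K·C_w²`. [folklore] -/
theorem abs_transportTail_le {K w : EKer 4} {CK Cw : ℝ} {N : ℕ} (hN : 1 ≤ N)
    (hK : ∀ c e (z : Pt), |K c e z| ≤ CK / ((supNorm z : ℝ) + 1) ^ 6)
    (hws : ∀ κ l, Summable fun u => |w κ l u|) (hwm : ∀ κ l, ∑' u, |w κ l u| ≤ Cw / N) (v : Pt) (a b : Fin 4) :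
    |(N : ℝ) ^ 8 * dressedEntry w (fun c e t => K c e t - truncK K N c e t) ((N : ℤ) • v) a b| ≤ 16 * CK * Cw ^ 2 := by
  have hN' : (0 : ℝ) < N := by exact_mod_cast hN
  have hCK : 0 ≤ CK := by
    have h := hK 0 0 0
    have hs : ((supNorm (0 : Pt) : ℝ) + 1) = 1 := by rw [DyadicShell.supNorm_eq_zero_iff.mpr rfl]; simp
    rw [hs, one_pow, div_one] at h
    exact (abs_nonneg _).trans h
  have hent := abs_dressedEntry_le_of_sup (T := fun c e t => K c e t - truncK K N c e t) hws hwm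
    (fun c e z => abs_tail_le hK c e z) ((N : ℤ) • v) a b
  rw [abs_mul, abs_of_nonneg (by positivity : (0 : ℝ) ≤ (N : ℝ) ^ 8)]
  calc (N : ℝ) ^ 8 * |dressedEntry w (fun c e t => K c e t - truncK K N c e t) ((N : ℤ) • v) a b|
      ≤ (N : ℝ) ^ 8 * (16 * (CK / ((N : ℝ) + 1) ^ 6) * (Cw / N) ^ 2) := mul_le_mul_of_nonneg_left hent (by positivity)
    _ = 16 * CK * Cw ^ 2 * ((N : ℝ) ^ 6 / ((N : ℝ) + 1) ^ 6) := by field_simp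
    _ ≤ 16 * CK * Cw ^ 2 * 1 := by
        apply mul_le_mul_of_nonneg_left _ (by positivity)
        rw [div_le_one (by positivity)]
        exact pow_le_pow_left₀ hN'.le (by linarith) 6
    _ = 16 * CK * Cw ^ 2 := mul_one _

end Summit.QuantumFields.BalabanUV.Beta.FP.HorizontalBookkeepingNearTail

end
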